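import Summits.Ventures.LatticeQCDFlow.Scoring.BlockFactorStrongLaw
import Summits.Ventures.LatticeQCDFlow.Scoring.MeanSubtractionCLT

/-!
# Almost-sure consistency of the scorers' CENTRED estimator `Γ̂_c(t)` and of their windowed `τ̂^c(W)`; the scorer-exact Madras–Sokal window freezes almost surely

HONEST FRAMING: exact (Metropolis-corrected) sampling algorithms for lattice gauge theory;
figures of merit are autocorrelation/cost numbers at stated couplings and volumes; no
continuum-physics claim.

Venture `LatticeQCDFlow` (cell pub-lqcd), sub-topic `Scoring`; FANOUT row 16 (`su2-base`), GEN-8.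
NEW WORK of the cell over GEN-8's `BlockFactorStrongLaw` (the strong law for block factors, the
freezing lemma `ae_eventually_isMSWindow`), `MeanSubtractionCLT` (`acovHatC_add_const`, `blockFactor_shift`)
and GEN-6's `acovHatC`; no definition; nothing cited as a fact.

`BlockFactorStrongLaw` §3–§4 are stated for the known-mean `1/N` statistic `Γ̂`.  What the scorers
compute is `Γ̂_c(t) = (1/(N−t)) Σ_{i<N−t} (x_i − x̄_N)(x_{i+t} − x̄_N)`.  THIS FILE:

* `acovHatC_expand` — for `t < N` the exact expansion
  `Γ̂_c(t)[Y] = S/(N−t) − ȳ_N · A/(N−t) + ȳ_N²`, `S = Σ_{i<N−t} Y_iY_{i+t}`, `A = Σ_{i<N−t} (Y_i + Y_{i+t})`.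
* **`ae_tendsto_acovHatC_blockFactor`** — `ξ` i.i.d., `X_i = F(ξ_i..ξ_{i+m})`, `X_0 ∈ L²`:
  `Γ̂_c(t)[X] → γ(t) = E[(X_0 − μ)(X_t − μ)]` almost surely, at every lag (three strong laws: lag
  products, the sequence, the shifted sequence — each along `N − t`).
* **`ae_tendsto_tauIntWindowC_blockFactor`** — `tauIntWindow (Γ̂_c(·)/Γ̂_c(0)) W → tauIntWindow (γ(·)/γ(0)) W`
  a.s. for ALL `W` at once (`γ(0) ≠ 0`).
* **`ae_eventually_isMSWindowC_blockFactor`** — at a strict population crossing `w` (`c > 0`), almost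
  surely `w` IS the Madras–Sokal window of the scorers' empirical curve `W ↦ τ̂^c_N(W)` for all large `N`.

NOT CLAIMED: rates; Markov-chain data.
-/

noncomputable section

open MeasureTheory ProbabilityTheory Filter Finset
open scoped Topology
open Literature.Probability.MarkovChains (seqMean)

namespace Summit.Ventures.LatticeQCDFlow.Scoring

/-! ## §1 The expansion -/

section Algebra

variable {Ω : Type*}

/-- **Exact expansion of the centred estimator** (`t < N`):
`Γ̂_c(t)[Y] = S/(N−t) − ȳ_N · A/(N−t) + ȳ_N²`. -/
theorem acovHatC_expand (Y : ℕ → Ω → ℝ) {N t : ℕ} (ht : t < N) (ω : Ω) :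
    acovHatC Y N t ω
      = (∑ i ∈ range (N - t), Y i ω * Y (i + t) ω) / ((N - t : ℕ) : ℝ)
        - seqMean N Y ω * ((∑ i ∈ range (N - t), (Y i ω + Y (i + t) ω)) / ((N - t : ℕ) : ℝ))
        + seqMean N Y ω ^ 2 := by
  have hNt : (0 : ℝ) < ((N - t : ℕ) : ℝ) := by exact_mod_cast Nat.sub_pos_of_lt ht
  have hexp : ∑ i ∈ range (N - t), (Y i ω - seqMean N Y ω) * (Y (i + t) ω - seqMean N Y ω)
      = ∑ i ∈ range (N - t), Y i ω * Y (i + t) ω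
        - seqMean N Y ω * ∑ i ∈ range (N - t), (Y i ω + Y (i + t) ω)
        + ((N - t : ℕ) : ℝ) * seqMean N Y ω ^ 2 := by
    rw [mul_sum, ← sum_sub_distrib]
    have : ∀ i ∈ range (N - t), (Y i ω - seqMean N Y ω) * (Y (i + t) ω - seqMean N Y ω)
        = (Y i ω * Y (i + t) ω - seqMean N Y ω * (Y i ω + Y (i + t) ω)) + seqMean N Y ω ^ 2 :=
      fun i _ => by ring
    rw [sum_congr rfl this, sum_add_distrib, sum_const, card_range, nsmul_eq_mul]
  rw [acovHatC, hexp]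
  field_simp

end Algebra

/-! ## §2 Almost-sure consistency of `Γ̂_c(t)` -/

section Consistency

variable {Ω : Type*} [MeasurableSpace Ω] {P : Measure Ω} [IsProbabilityMeasure P]
variable {S : Type*} [MeasurableSpace S] {ξ : ℕ → Ω → S} {m : ℕ} {F : (Fin (m + 1) → S) → ℝ}

/-- **`Γ̂_c(t) → γ(t)` almost surely** for every block-factor process with `X_0 ∈ L²`. -/
theorem ae_tendsto_acovHatC_blockFactor (hξ : ∀ i, Measurable (ξ i)) (hind : iIndepFun ξ P)
    (hid : ∀ i, IdentDistrib (ξ i) (ξ 0) P P) (hF : Measurable F)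
    (h2 : MemLp (blockFactor F ξ 0) 2 P) (t : ℕ) :
    ∀ᵐ ω ∂P, Tendsto (fun N : ℕ => acovHatC (blockFactor F ξ) N t ω) atTop
      (𝓝 P[fun ω => (blockFactor F ξ 0 ω - P[blockFactor F ξ 0])
        * (blockFactor F ξ t ω - P[blockFactor F ξ 0])]) := by
  set μ : ℝ := P[blockFactor F ξ 0] with hμ
  set Fc : (Fin (m + 1) → S) → ℝ := fun w => F w - μ with hFc
  have hFc_m : Measurable Fc := hF.sub_const _
  have hY : ∀ i ω, blockFactor Fc ξ i ω = blockFactor F ξ i ω - μ := fun i ω => rfl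
  have h2c : MemLp (blockFactor Fc ξ 0) 2 P := h2.sub (memLp_const _)
  have h2ci : ∀ i, MemLp (blockFactor Fc ξ i) 2 P := memLp_blockFactor hind hid hFc_m h2c
  have hmean0 : P[blockFactor Fc ξ 0] = 0 := by
    simp only [hY]
    rw [integral_sub (h2.integrable one_le_two) (integrable_const _), integral_const, smul_eq_mul]
    simp [hμ]
  -- (1) lag products: `S_K/K → γ(t)` along `K`, then along `K = N − t`
  have h1 : ∀ s, Integrable (fun ω => blockFactor Fc ξ 0 ω * blockFactor Fc ξ s ω) P :=
    fun s => h2c.integrable_mul (h2ci s)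
  have hS := ae_tendsto_acovHat_blockFactor hξ hind hid hFc_m h1 t
  -- (2) the sequence: `ȳ_N → 0`
  have hYbar := strong_law_blockFactor hξ hind hid hFc_m (h2c.integrable one_le_two)
  -- (3) the shifted sequence `i ↦ Y_{i+t}`: its means `→ 0`
  have hind' : iIndepFun (fun j => ξ (j + t)) P := hind.precomp (add_left_injective t)
  have hid' : ∀ i, IdentDistrib (ξ (i + t)) (ξ (0 + t)) P P := fun i =>
    (hid (i + t)).trans (by simpa only [zero_add] using (hid t).symm)
  have h2s : MemLp (blockFactor Fc (fun j => ξ (j + t)) 0) 2 P := by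
    have e : blockFactor Fc (fun j => ξ (j + t)) 0 = blockFactor Fc ξ (0 + t) :=
      funext fun ω => blockFactor_shift Fc ξ t 0 ω
    rw [e]; exact h2ci _
  have hShift := strong_law_blockFactor (fun i => hξ (i + t)) hind' hid' hFc_m (h2s.integrable one_le_two)
  have hmeanS : P[blockFactor Fc (fun j => ξ (j + t)) 0] = 0 := by
    have e : blockFactor Fc (fun j => ξ (j + t)) 0 = blockFactor Fc ξ (0 + t) :=
      funext fun ω => blockFactor_shift Fc ξ t 0 ω
    rw [e, integral_blockFactor hind hid hFc_m, hmean0]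
  rw [hmean0] at hYbar
  rw [hmeanS] at hShift
  filter_upwards [hS, hYbar, hShift] with ω hSω hYω hShω
  -- along `N − t`
  have hsub := tendsto_sub_atTop_nat t
  have hS' : Tendsto (fun N : ℕ => (∑ i ∈ range (N - t), blockFactor Fc ξ i ω * blockFactor Fc ξ (i + t) ω)
      / ((N - t : ℕ) : ℝ)) atTop (𝓝 P[fun ω => blockFactor Fc ξ 0 ω * blockFactor Fc ξ t ω]) := by
    have h := hSω.comp hsub
    refine h.congr fun N => ?_
    simp only [Function.comp, acovHat_apply]
  have hA' : Tendsto (fun N : ℕ => (∑ i ∈ range (N - t), (blockFactor Fc ξ i ω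
      + blockFactor Fc ξ (i + t) ω)) / ((N - t : ℕ) : ℝ)) atTop (𝓝 (0 + 0)) := by
    have hB := hYω.comp hsub
    have hC := hShω.comp hsub
    refine (hB.add hC).congr fun N => ?_
    simp only [Function.comp, blockFactor_shift, sum_add_distrib, add_div]
  rw [add_zero] at hA'
  -- assemble on `N > t`
  have hlim : Tendsto (fun N : ℕ => (∑ i ∈ range (N - t), blockFactor Fc ξ i ω * blockFactor Fc ξ (i + t) ω)
        / ((N - t : ℕ) : ℝ)
      - seqMean N (blockFactor Fc ξ) ω * ((∑ i ∈ range (N - t), (blockFactor Fc ξ i ω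
          + blockFactor Fc ξ (i + t) ω)) / ((N - t : ℕ) : ℝ))
      + seqMean N (blockFactor Fc ξ) ω ^ 2) atTop
      (𝓝 (P[fun ω => blockFactor Fc ξ 0 ω * blockFactor Fc ξ t ω] - 0 * 0 + 0 ^ 2)) :=
    (hS'.sub (hYω.mul hA')).add (hYω.pow 2)
  simp only [mul_zero, sub_zero, zero_pow two_ne_zero, add_zero] at hlim
  refine (hlim.congr' ?_)
  filter_upwards [eventually_gt_atTop t] with N hN
  have hN0 : N ≠ 0 := by omega
  have hX : blockFactor F ξ = fun i ω => blockFactor Fc ξ i ω + μ := by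
    funext i ω; rw [hY]; ring
  rw [hX, acovHatC_add_const _ μ hN0, acovHatC_expand _ hN ω]

/-- **`τ̂^c_N(W) → τ_W` almost surely, for every window at once** (`γ(0) ≠ 0`). -/
theorem ae_tendsto_tauIntWindowC_blockFactor (hξ : ∀ i, Measurable (ξ i)) (hind : iIndepFun ξ P)
    (hid : ∀ i, IdentDistrib (ξ i) (ξ 0) P P) (hF : Measurable F)
    (h2 : MemLp (blockFactor F ξ 0) 2 P)
    (hσ : P[fun ω => (blockFactor F ξ 0 ω - P[blockFactor F ξ 0])
      * (blockFactor F ξ 0 ω - P[blockFactor F ξ 0])] ≠ 0) :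
    ∀ᵐ ω ∂P, ∀ W : ℕ, Tendsto (fun N : ℕ => tauIntWindow (fun t => acovHatC (blockFactor F ξ) N t ω
        / acovHatC (blockFactor F ξ) N 0 ω) W) atTop
      (𝓝 (tauIntWindow (fun t => P[fun ω => (blockFactor F ξ 0 ω - P[blockFactor F ξ 0])
          * (blockFactor F ξ t ω - P[blockFactor F ξ 0])]
        / P[fun ω => (blockFactor F ξ 0 ω - P[blockFactor F ξ 0])
          * (blockFactor F ξ 0 ω - P[blockFactor F ξ 0])]) W)) := by
  have hall := ae_all_iff.2 fun t => ae_tendsto_acovHatC_blockFactor hξ hind hid hF h2 t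
  filter_upwards [hall] with ω hω W
  simp only [tauIntWindow]
  exact tendsto_const_nhds.add (tendsto_finsetSum _ fun t _ => (hω (t + 1)).div (hω 0) hσ)

/-- **THE SCORER-EXACT WINDOW FREEZES.**  At a strict population crossing `w` (`c > 0`), almost surely
`w` is the Madras–Sokal window of the scorers' empirical curve `W ↦ τ̂^c_N(W)` for all large `N`. -/
theorem ae_eventually_isMSWindowC_blockFactor (hξ : ∀ i, Measurable (ξ i)) (hind : iIndepFun ξ P)
    (hid : ∀ i, IdentDistrib (ξ i) (ξ 0) P P) (hF : Measurable F)
    (h2 : MemLp (blockFactor F ξ 0) 2 P)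
    (hσ : P[fun ω => (blockFactor F ξ 0 ω - P[blockFactor F ξ 0])
      * (blockFactor F ξ 0 ω - P[blockFactor F ξ 0])] ≠ 0) {c : ℝ} (hc : 0 < c) {w : ℕ}
    (hw : IsStrictMSWindow c (fun W => tauIntWindow (fun t =>
      P[fun ω => (blockFactor F ξ 0 ω - P[blockFactor F ξ 0]) * (blockFactor F ξ t ω - P[blockFactor F ξ 0])]
        / P[fun ω => (blockFactor F ξ 0 ω - P[blockFactor F ξ 0])
          * (blockFactor F ξ 0 ω - P[blockFactor F ξ 0])]) W) w) :
    ∀ᵐ ω ∂P, ∀ᶠ N in atTop, IsMSWindow c (fun W => tauIntWindow (fun t =>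
      acovHatC (blockFactor F ξ) N t ω / acovHatC (blockFactor F ξ) N 0 ω) W) w :=
  ae_eventually_isMSWindow (τhat := fun N W ω => tauIntWindow (fun t =>
      acovHatC (blockFactor F ξ) N t ω / acovHatC (blockFactor F ξ) N 0 ω) W) hc hw
    (ae_tendsto_tauIntWindowC_blockFactor hξ hind hid hF h2 hσ)

end Consistency

end Summit.Ventures.LatticeQCDFlow.Scoring

end
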